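import Literature.AlgebraicGeometry.HodgeTheory.RationalHodgeClasses
import Literature.AlgebraicGeometry.Motives.BettiCycleClassFiniteProofs
import HarnessLib

/-!
# The rational lattice `Hᵏ(Y; ℚ) → Hᵏ(Y; ℂ)`: rational classes as an injective image

Family `hodge`, layer `Literature/AlgebraicGeometry/HodgeTheory`. Companion to
`RationalHodgeClasses`, whose predicate `IsRationalClass c` on a class `c ∈ Hᵏ(Y; ℂ) =
singularCohomology ℂ ℂ Y k` says that `c` is represented by a singular cocycle with values in
`ℚ ⊆ ℂ`, "i.e. `c` lies in the image of `Hᵏ(Y; ℚ) → Hᵏ(Y; ℂ)`". This file makes that map and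
the "i.e." precise on the tree's real singular cochains (Hatcher 2002, §3.1: cochains are
functions on singular simplices, `δφ(σ) = ∑ (-1)ⁱ φ(σ|[v₀,…,v̂ᵢ,…])`, and a homomorphism of
coefficient groups induces a cochain map, p. 198), and proves the facts about it that the
Hodge-theory files use silently:

* `ofRatCochain k : Cᵏ(Y; ℚ) →+ Cᵏ(Y; ℂ)`, `cocycleOfRat Y k : Zᵏ(Y; ℚ) →+ Zᵏ(Y; ℂ)` (change of
  coefficients along `ℚ ↪ ℂ`, commuting with `δ`: `d_ofRatCochain`), and
  `isRationalClass_iff_exists_cocycleOfRat`: `IsRationalClass c ↔ c = [ζ ⊗ 1]` for a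
  `ℚ`-cocycle `ζ` — the "i.e." of the docstring of `IsRationalClass`.
* `π_cocycleOfRat_eq_zero_iff` (**`Hᵏ(Y; ℚ) → Hᵏ(Y; ℂ)` is injective**, for every space `Y`):
  `[ζ ⊗ 1] = 0 ↔ [ζ] = 0`. Proof: if `ζ ⊗ 1 = δθ` for a `ℂ`-valued cochain `θ`, apply a
  `ℚ`-linear retraction `ρ : ℂ → ℚ` of the inclusion (`ratRetraction`) to the values of `θ`;
  `δ` commutes with `ρ` (`d_reCochain`), so `ζ = δ(ρ ∘ θ)`. (Over a field this also follows
  from `Hᵏ(Y; F) = Hom(Hₖ(Y), F)`, Hatcher Thm. 3.2; the retraction avoids universal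
  coefficients.)
* `exists_d_eq_iCocycles_of_π_eq_zero`: a cocycle with zero class is a coboundary (the
  concrete description of `ModuleCat` homology, `ShortComplex.moduleCatCyclesIso`).
* `finite_singularCohomology_rat_complexPoints`: for `X` smooth projective of dimension `n` over
  `ℂ`, `Hᵏ(X(ℂ); ℚ)` is finite-dimensional — the proof of the `ℤ`-version
  `Motives.bettiCohomologyInt_finite_holds` (`X(ℂ)` is a compact Hausdorff `2n`-manifold by the
  algebraic charts of Serre, GAGA §2; Hatcher App. A Cor. A.8–A.9, §3.1 Cor. 3.3; all proved in
  the tree) with `ℚ` in place of `ℤ`.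

First consumer: the finiteness of the `ℚ`-space of rational classes of a smooth projective
variety (`Literature/Barriers/HodgeConjecture/GeneralizedHodgeTrivialReasonsSubHodge`, named
fact `smoothProjective_rationalClasses_finiteRatBasis`; Grothendieck 1969).

Technical: as in `Literature.AlgebraicTopology.SingularHomology.CohomologyFiniteness`, the
cochain modules of the tree's complex are function types up to unfolding, whence
`backward.isDefEq.respectTransparency false`.

## References

* A. Hatcher, *Algebraic Topology* (2002), §3.1 (pp. 190–191, Thm. 3.2, p. 198), App. A
  Cor. A.8–A.9.
* J.-P. Serre, *GAGA*, Ann. Inst. Fourier 6 (1956), §2.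
-/

noncomputable section

open CategoryTheory

universe u v

namespace Literature.AlgebraicGeometry.HodgeTheory

section HodgeTheory

-- the cochain modules of `singularCochainComplex` are function types up to unfolding
set_option backward.isDefEq.respectTransparency false

open Literature.AlgebraicTopology.SingularHomology singularCochainComplex

variable {Y : Type u} [TopologicalSpace Y]

/-! ### A cocycle with zero class is a coboundary -/

section Exact

variable (R : Type v) [CommRing R] (M : Type v) [AddCommGroup M] [Module R M]

/-- **A singular cocycle whose cohomology class vanishes is a coboundary**: if `[x] = 0` in
`Hʲ(Y; M)` then `x = δy` for a cochain `y` of the previous degree `i` (Hatcher 2002, §3.1: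
`Hʲ = ker δ / im δ`); read off the concrete description of the homology of a short complex of
modules (`ShortComplex.moduleCatCyclesIso`, `ShortComplex.moduleCatHomologyIso`).
[cite: HatcherAT2002, §3.1 p. 191] -/
theorem exists_d_eq_iCocycles_of_π_eq_zero {i j : ℕ} (hij : (ComplexShape.up ℕ).prev j = i)
    (x : cocycles R M Y j) (hx : singularCohomology.π R M Y j x = 0) :
    ∃ y : (singularCochainComplex R M Y).X i,
      (singularCochainComplex R M Y).d i j y = iCocycles R M Y j x := by
  subst hij
  have h1 : ((singularCochainComplex R M Y).sc j).moduleCatLeftHomologyData.π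
      (((singularCochainComplex R M Y).sc j).moduleCatCyclesIso.hom x) = 0 := by
    rw [← ShortComplex.π_moduleCatCyclesIso_hom_apply]
    change ((singularCochainComplex R M Y).sc j).moduleCatHomologyIso.hom
      (singularCohomology.π R M Y j x) = 0
    rw [hx, map_zero]
  have h2 : ((singularCochainComplex R M Y).sc j).moduleCatCyclesIso.hom x ∈
      LinearMap.range ((singularCochainComplex R M Y).sc j).moduleCatToCycles :=
    (Submodule.Quotient.mk_eq_zero _).1 h1
  obtain ⟨y, hy⟩ := h2
  refine ⟨y, ?_⟩
  have h3 : ((((singularCochainComplex R M Y).sc j).moduleCatToCycles y :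
      LinearMap.ker ((singularCochainComplex R M Y).sc j).g.hom) :
        ((singularCochainComplex R M Y).sc j).X₂) =
      ((singularCochainComplex R M Y).sc j).iCycles x := by
    rw [hy, ← ShortComplex.moduleCatCyclesIso_hom_i_apply]
    rfl
  exact h3

/-- In degree `0` a cocycle with zero class is zero (the previous differential is `0`).
[cite: HatcherAT2002, §3.1 p. 198] -/
theorem cocycles_eq_zero_of_π_eq_zero (x : cocycles R M Y 0)
    (hx : singularCohomology.π R M Y 0 x = 0) : x = 0 := by
  obtain ⟨y, hy⟩ := exists_d_eq_iCocycles_of_π_eq_zero R M CochainComplex.prev_nat_zero x hx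
  rw [(singularCochainComplex R M Y).shape 0 0 (by simp)] at hy
  refine cocycles_ext ?_
  rw [map_zero, ← hy]
  rfl

/-- In degree `k + 1` a cocycle with zero class is `δ` of a `k`-cochain.
[cite: HatcherAT2002, §3.1 p. 191] -/
theorem exists_toCocycles_eq_of_π_eq_zero {k : ℕ} (x : cocycles R M Y (k + 1))
    (hx : singularCohomology.π R M Y (k + 1) x = 0) :
    ∃ y : (singularCochainComplex R M Y).X k, toCocycles R M Y k (k + 1) y = x := by
  obtain ⟨y, hy⟩ :=
    exists_d_eq_iCocycles_of_π_eq_zero R M (CochainComplex.prev_nat_succ k) x hx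
  exact ⟨y, cocycles_ext (by rw [iCocycles_toCocycles, hy])⟩

end Exact

/-! ### Change of coefficients `ℚ → ℂ` on cochains and cocycles -/

/-- A `ℚ`-valued singular cochain regarded as a `ℂ`-valued one: change of coefficients
`Cᵏ(Y; ℚ) →+ Cᵏ(Y; ℂ)` along `ℚ ↪ ℂ` (Hatcher 2002, §3.1, p. 198: a homomorphism of coefficient
groups induces a cochain map). [cite: HatcherAT2002, §3.1 p. 198] -/
def ofRatCochain (k : ℕ) :
    (singularCochainComplex ℚ ℚ Y).X k →+ (singularCochainComplex ℂ ℂ Y).X k where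
  toFun φ σ := ((φ σ : ℚ) : ℂ)
  map_zero' := singularCochainComplex.ext fun σ ↦ by
    change (((0 : ℚ)) : ℂ) = (0 : ℂ)
    exact Rat.cast_zero
  map_add' φ ψ := singularCochainComplex.ext fun σ ↦ by
    change (((φ σ + ψ σ : ℚ)) : ℂ) = ((φ σ : ℚ) : ℂ) + ((ψ σ : ℚ) : ℂ)
    exact Rat.cast_add _ _

/-- Pointwise formula (definitional). [folklore] -/
@[simp]
theorem ofRatCochain_apply {k : ℕ} (φ : (singularCochainComplex ℚ ℚ Y).X k)
    (σ : SingularSimplex Y k) : ofRatCochain k φ σ = ((φ σ : ℚ) : ℂ) := rfl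

/-- Change of coefficients is injective (`ℚ → ℂ` is). [folklore] -/
theorem ofRatCochain_injective (k : ℕ) : Function.Injective (ofRatCochain (Y := Y) k) :=
  fun _ _ h ↦ singularCochainComplex.ext fun σ ↦ Rat.cast_injective (congrFun h σ)

/-- Change of coefficients is `ℚ`-homogeneous. [folklore] -/
theorem ofRatCochain_smul {k : ℕ} (q : ℚ) (φ : (singularCochainComplex ℚ ℚ Y).X k) :
    ofRatCochain k (q • φ) = ((q : ℚ) : ℂ) • ofRatCochain k φ :=
  singularCochainComplex.ext fun σ ↦ by
    change (((q * φ σ : ℚ)) : ℂ) = (q : ℂ) * ((φ σ : ℚ) : ℂ)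
    exact Rat.cast_mul _ _

/-- **Change of coefficients commutes with the coboundary**: `δ(φ ⊗ 1) = (δφ) ⊗ 1`
(`δφ(σ) = ∑ (-1)ⁱ φ(σ ∘ δᵢ)` has integer coefficients; Hatcher 2002, §3.1).
[cite: HatcherAT2002, §3.1 p. 191] -/
theorem d_ofRatCochain {k : ℕ} (φ : (singularCochainComplex ℚ ℚ Y).X k) :
    (singularCochainComplex ℂ ℂ Y).d k (k + 1) (ofRatCochain k φ) =
      ofRatCochain (k + 1) ((singularCochainComplex ℚ ℚ Y).d k (k + 1) φ) := by
  refine singularCochainComplex.ext fun σ ↦ ?_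
  rw [ofRatCochain_apply, d_apply, d_apply, Rat.cast_sum]
  refine Finset.sum_congr rfl fun i _ ↦ ?_
  rw [smul_eq_mul, smul_eq_mul, Rat.cast_mul, Rat.cast_pow, Rat.cast_neg, Rat.cast_one]
  rfl

/-- A `ℂ`-valued cochain read through a `ℚ`-linear map `ρ : ℂ → ℚ` on its values. [folklore] -/
def reCochain (ρ : ℂ →ₗ[ℚ] ℚ) (k : ℕ) (θ : (singularCochainComplex ℂ ℂ Y).X k) :
    (singularCochainComplex ℚ ℚ Y).X k :=
  fun σ ↦ ρ (θ σ)

/-- `reCochain` commutes with the coboundary as well (same integrality of `δ`).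
[cite: HatcherAT2002, §3.1 p. 191] -/
theorem d_reCochain (ρ : ℂ →ₗ[ℚ] ℚ) {k : ℕ} (θ : (singularCochainComplex ℂ ℂ Y).X k) :
    (singularCochainComplex ℚ ℚ Y).d k (k + 1) (reCochain ρ k θ) =
      reCochain ρ (k + 1) ((singularCochainComplex ℂ ℂ Y).d k (k + 1) θ) := by
  refine singularCochainComplex.ext fun σ ↦ ?_
  change _ = ρ ((singularCochainComplex ℂ ℂ Y).d k (k + 1) θ σ)
  rw [d_apply, d_apply, map_sum]
  refine Finset.sum_congr rfl fun i _ ↦ ?_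
  change ((-1 : ℚ) ^ (i : ℕ)) • ρ (θ (σ.face i)) = ρ (((-1 : ℂ) ^ (i : ℕ)) • θ (σ.face i))
  rw [← map_smul, Rat.smul_def, Rat.cast_pow, Rat.cast_neg, Rat.cast_one, smul_eq_mul]

/-- `reCochain ρ ∘ ofRatCochain = id` for a retraction `ρ` of `ℚ ↪ ℂ`. [folklore] -/
theorem reCochain_ofRatCochain (ρ : ℂ →ₗ[ℚ] ℚ) (hρ : ∀ q : ℚ, ρ ((q : ℚ) : ℂ) = q) (k : ℕ)
    (φ : (singularCochainComplex ℚ ℚ Y).X k) : reCochain ρ k (ofRatCochain k φ) = φ :=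
  singularCochainComplex.ext fun σ ↦ hρ (φ σ)

/-- `ζ ⊗ 1` is a cocycle for a cocycle `ζ`: `δ(ζ ⊗ 1) = (δζ) ⊗ 1 = 0`. [cite: HatcherAT2002, §3.1 p. 198] -/
theorem d_ofRatCochain_iCocycles {k : ℕ} (ζ : cocycles ℚ ℚ Y k) :
    (singularCochainComplex ℂ ℂ Y).d k (k + 1) (ofRatCochain k (iCocycles ℚ ℚ Y k ζ)) = 0 := by
  rw [d_ofRatCochain, d_iCocycles, map_zero]

variable (Y) in
/-- **Change of coefficients on cocycles**, `Zᵏ(Y; ℚ) →+ Zᵏ(Y; ℂ)`, `ζ ↦ ζ ⊗ 1` (well defined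
by `d_ofRatCochain`; additive and `ℚ`-homogeneous, `cocycleOfRat_smul` — `Zᵏ(Y; ℂ)` carries
no `Module ℚ` instance). [cite: HatcherAT2002, §3.1 p. 198] -/
def cocycleOfRat (k : ℕ) : cocycles ℚ ℚ Y k →+ cocycles ℂ ℂ Y k where
  toFun ζ := cocyclesMk (ofRatCochain k (iCocycles ℚ ℚ Y k ζ)) (d_ofRatCochain_iCocycles ζ)
  map_zero' := cocycles_ext (by rw [iCocycles_mk, map_zero, map_zero, map_zero])
  map_add' ζ ζ' := cocycles_ext (by rw [iCocycles_mk, map_add, map_add, map_add, iCocycles_mk,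
    iCocycles_mk])

/-- The underlying cochain of `ζ ⊗ 1` is `ζ ⊗ 1`. [folklore] -/
@[simp]
theorem iCocycles_cocycleOfRat {k : ℕ} (ζ : cocycles ℚ ℚ Y k) :
    iCocycles ℂ ℂ Y k (cocycleOfRat Y k ζ) = ofRatCochain k (iCocycles ℚ ℚ Y k ζ) :=
  iCocycles_mk _ (d_ofRatCochain_iCocycles ζ)

/-- `cocycleOfRat` is `ℚ`-homogeneous. [folklore] -/
theorem cocycleOfRat_smul {k : ℕ} (q : ℚ) (ζ : cocycles ℚ ℚ Y k) :
    cocycleOfRat Y k (q • ζ) = ((q : ℚ) : ℂ) • cocycleOfRat Y k ζ :=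
  cocycles_ext (by rw [iCocycles_cocycleOfRat, map_smul (iCocycles ℚ ℚ Y k).hom,
    map_smul (iCocycles ℂ ℂ Y k).hom, iCocycles_cocycleOfRat, ofRatCochain_smul])

/-- `(δy) ⊗ 1 = δ(y ⊗ 1)` on cocycles. [cite: HatcherAT2002, §3.1 p. 198] -/
theorem cocycleOfRat_toCocycles {k : ℕ} (y : (singularCochainComplex ℚ ℚ Y).X k) :
    cocycleOfRat Y (k + 1) (toCocycles ℚ ℚ Y k (k + 1) y) =
      toCocycles ℂ ℂ Y k (k + 1) (ofRatCochain k y) :=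
  cocycles_ext (by rw [iCocycles_cocycleOfRat, iCocycles_toCocycles, iCocycles_toCocycles,
    d_ofRatCochain])

/-- The class of `ζ ⊗ 1` is a rational class. [cite: HatcherAT2002, §3.1] -/
theorem isRationalClass_π_cocycleOfRat {k : ℕ} (ζ : cocycles ℚ ℚ Y k) :
    IsRationalClass (singularCohomology.π ℂ ℂ Y k (cocycleOfRat Y k ζ)) :=
  ⟨_, rfl, fun σ ↦ ⟨iCocycles ℚ ℚ Y k ζ σ, by
    rw [iCocycles_cocycleOfRat, ofRatCochain_apply, eq_ratCast]⟩⟩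

/-- Conversely a rational class is the class of `ζ ⊗ 1` for a `ℚ`-cocycle `ζ`: a `ℚ`-valued
`ℂ`-cocycle is `φ ⊗ 1` for a `ℚ`-cochain `φ`, and `δφ = 0` because `(δφ) ⊗ 1 = δ(φ ⊗ 1) = 0`.
[cite: HatcherAT2002, §3.1] -/
theorem IsRationalClass.exists_cocycleOfRat {k : ℕ} {c : singularCohomology ℂ ℂ Y k}
    (hc : IsRationalClass c) :
    ∃ ζ : cocycles ℚ ℚ Y k, singularCohomology.π ℂ ℂ Y k (cocycleOfRat Y k ζ) = c := by
  obtain ⟨z, rfl, hz⟩ := hc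
  choose φ hφ using hz
  have hφz : ofRatCochain k (φ : (singularCochainComplex ℚ ℚ Y).X k) = iCocycles ℂ ℂ Y k z :=
    singularCochainComplex.ext fun σ ↦ by rw [ofRatCochain_apply, ← hφ σ, eq_ratCast]
  have hdφ : (singularCochainComplex ℚ ℚ Y).d k (k + 1) (φ : (singularCochainComplex ℚ ℚ Y).X k)
      = 0 := by
    apply ofRatCochain_injective (Y := Y) (k + 1)
    rw [← d_ofRatCochain, hφz, d_iCocycles, map_zero]
  refine ⟨cocyclesMk φ hdφ, congrArg _ (cocycles_ext ?_)⟩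
  rw [iCocycles_cocycleOfRat, iCocycles_mk, ← hφz]

/-- **`IsRationalClass c ↔ c` is in the image of `Hᵏ(Y; ℚ) → Hᵏ(Y; ℂ)`** (the "i.e." in the
docstring of `IsRationalClass`), the image being computed on cocycles as `ζ ↦ [ζ ⊗ 1]`.
[cite: HatcherAT2002, §3.1] -/
theorem isRationalClass_iff_exists_cocycleOfRat {k : ℕ} (c : singularCohomology ℂ ℂ Y k) :
    IsRationalClass c ↔
      ∃ ζ : cocycles ℚ ℚ Y k, singularCohomology.π ℂ ℂ Y k (cocycleOfRat Y k ζ) = c :=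
  ⟨IsRationalClass.exists_cocycleOfRat, fun ⟨ζ, hζ⟩ ↦ hζ ▸ isRationalClass_π_cocycleOfRat ζ⟩

/-- A `ℚ`-linear retraction of the inclusion `ℚ ↪ ℂ` (choice; `ℂ` is a `ℚ`-vector space and
the inclusion is injective; Mathlib's `LinearMap.leftInverse`). [folklore] -/
def ratRetraction : ℂ →ₗ[ℚ] ℚ := (Algebra.linearMap ℚ ℂ).leftInverse

/-- `ratRetraction` is a retraction: `ρ(q) = q` for `q ∈ ℚ`. [folklore] -/
@[simp]
theorem ratRetraction_ratCast (q : ℚ) : ratRetraction ((q : ℚ) : ℂ) = q := by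
  have h : ((q : ℚ) : ℂ) = Algebra.linearMap ℚ ℂ q := (eq_ratCast (algebraMap ℚ ℂ) q).symm
  rw [h, ratRetraction, LinearMap.leftInverse_apply_of_inj]
  exact LinearMap.ker_eq_bot.2 (algebraMap ℚ ℂ).injective

/-- **`Hᵏ(Y; ℚ) → Hᵏ(Y; ℂ)` is injective**, on cocycles: `[ζ ⊗ 1] = 0 ↔ [ζ] = 0`, for every
topological space `Y` and every `k`. (`←`: `(δy) ⊗ 1 = δ(y ⊗ 1)`. `→`: if `ζ ⊗ 1 = δθ`, then
`ζ = ρ ∘ (ζ ⊗ 1) = ρ ∘ δθ = δ(ρ ∘ θ)` for a `ℚ`-linear retraction `ρ` of `ℚ ↪ ℂ`.) Over a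
field this is also immediate from `Hᵏ(Y; F) = Hom(Hₖ(Y), F)` (Hatcher, Thm. 3.2).
[cite: HatcherAT2002, §3.1 Thm. 3.2 and p. 198] -/
theorem π_cocycleOfRat_eq_zero_iff {k : ℕ} (ζ : cocycles ℚ ℚ Y k) :
    singularCohomology.π ℂ ℂ Y k (cocycleOfRat Y k ζ) = 0 ↔
      singularCohomology.π ℚ ℚ Y k ζ = 0 := by
  cases k with
  | zero =>
    constructor
    · intro h
      have h0 := cocycles_eq_zero_of_π_eq_zero ℂ ℂ _ h
      have h1 : iCocycles ℚ ℚ Y 0 ζ = 0 := by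
        apply ofRatCochain_injective (Y := Y) 0
        rw [← iCocycles_cocycleOfRat, h0, map_zero, map_zero]
      rw [cocycles_ext (h1.trans (map_zero _).symm), map_zero]
    · intro h
      rw [cocycles_eq_zero_of_π_eq_zero ℚ ℚ ζ h, map_zero, map_zero]
  | succ k =>
    constructor
    · intro h
      obtain ⟨θ, hθ⟩ := exists_toCocycles_eq_of_π_eq_zero ℂ ℂ _ h
      have hd : (singularCochainComplex ℚ ℚ Y).d k (k + 1) (reCochain ratRetraction k θ) =
          iCocycles ℚ ℚ Y (k + 1) ζ := by
        rw [d_reCochain, ← iCocycles_toCocycles, hθ, iCocycles_cocycleOfRat,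
          reCochain_ofRatCochain _ ratRetraction_ratCast]
      have hζ : ζ = toCocycles ℚ ℚ Y k (k + 1) (reCochain ratRetraction k θ) :=
        cocycles_ext (by rw [iCocycles_toCocycles, hd])
      rw [hζ, π_toCocycles]
    · intro h
      obtain ⟨y, rfl⟩ := exists_toCocycles_eq_of_π_eq_zero ℚ ℚ ζ h
      rw [cocycleOfRat_toCocycles, π_toCocycles]

/-- Hence `[ζ ⊗ 1] = [ζ' ⊗ 1] ↔ [ζ] = [ζ']`. [cite: HatcherAT2002, §3.1 Thm. 3.2 and p. 198] -/
theorem π_cocycleOfRat_eq_iff {k : ℕ} (ζ ζ' : cocycles ℚ ℚ Y k) :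
    singularCohomology.π ℂ ℂ Y k (cocycleOfRat Y k ζ) =
        singularCohomology.π ℂ ℂ Y k (cocycleOfRat Y k ζ') ↔
      singularCohomology.π ℚ ℚ Y k ζ = singularCohomology.π ℚ ℚ Y k ζ' := by
  rw [← sub_eq_zero, ← map_sub, ← map_sub, π_cocycleOfRat_eq_zero_iff, map_sub, sub_eq_zero]

/-! ### Finiteness of `Hᵏ(X(ℂ); ℚ)` for smooth projective `X` -/

/-- **`Hᵏ(X(ℂ); ℚ)` is finite-dimensional for `X` smooth projective of dimension `n` over `ℂ`**
(Hatcher 2002, App. A Cor. A.9 with Cor. A.8, and §3.1 Cor. 3.3, for the compact Hausdorff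
topological `2n`-manifold `X(ℂ)` — holomorphic algebraic charts `X(ℂ) ⇀ ℂⁿ ≃ₜ ℝ²ⁿ`, Serre GAGA
§2; compact because `X` is proper, Hausdorff because `X` is separated). The proof is that of
`Motives.bettiCohomologyInt_finite_holds` with `ℚ` for `ℤ`.
[cite: HatcherAT2002, App. A Cor. A.9 and §3.1 Cor. 3.3] -/
theorem finite_singularCohomology_rat_complexPoints {n : ℕ} {X : Motives.SchemeOver ℂ}
    (hX : Motives.IsSmoothProjective n X) (k : ℕ) :
    Module.Finite ℚ (singularCohomology ℚ ℚ (Motives.ComplexPoints X) k) := by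
  haveI := hX.smoothOfRelativeDimension
  haveI : AlgebraicGeometry.Smooth X.hom :=
    AlgebraicGeometry.SmoothOfRelativeDimension.smooth n X.hom
  choose chart mem _ using fun P : Motives.ComplexPoints X ↦
    Literature.NumberTheory.Transcendental.exists_algebraicChart_holds X n P
  let eC : (Fin n → ℂ) ≃ₜ EuclideanSpace ℝ (Fin (2 * n)) :=
    (ContinuousLinearEquiv.ofFinrankEq (𝕜 := ℝ) (by
      rw [Module.finrank_pi_fintype, finrank_euclideanSpace_fin]
      simp [Complex.finrank_real_complex, mul_comm])).toHomeomorph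
  letI : ChartedSpace (EuclideanSpace ℝ (Fin (2 * n))) (Motives.ComplexPoints X) :=
    { atlas := Set.range fun P ↦ (chart P).transHomeomorph eC
      chartAt := fun P ↦ (chart P).transHomeomorph eC
      mem_chart_source := fun P ↦ by
        rw [OpenPartialHomeomorph.transHomeomorph_source]; exact mem P
      chart_mem_atlas := fun P ↦ ⟨P, rfl⟩ }
  haveI : AlgebraicGeometry.IsProper X.hom := Motives.IsSmoothProjective.isProper_holds hX
  haveI : CompactSpace (Motives.ComplexPoints X) :=
    Motives.compactSpace_algPoints_of_isProper_holds X ℂ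
  haveI : T2Space (Motives.ComplexPoints X) := Motives.ComplexPoints.t2Space_of_isSeparated X
  exact finite_singularCohomology_of_compact_chartedSpace ℚ ℚ (d := 2 * n) k

end HodgeTheory

end Literature.AlgebraicGeometry.HodgeTheory

end
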